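import Summits.QuantumFields.YangMills.Theorems.BalabanUVNodesN07SeamWitnessStar
import Summits.QuantumFields.YangMills.Theorems.BalabanUVNodesK0AveragedSingleBondFloor
import HarnessLib

/-!
# N07 [B11] ∕ K0⁷ chart road — THE SEAM WITNESS, part B: the antisymmetric two-connector twist next to a twisted exterior bond leaves EVERY level-`≥ 1`
# average of record unchanged

Cell `pub-ymgap`, seat `pub-ymgap-dag-n07-w3` g15 (WIDTH SEAT 3 on N07).  `--kind proof --supports stmt-QuantumFields-20541 --as helper` (K0⁷; count-neutral;
NEGATIVE-SIDE helper).  [I] = [Balaban1987RG1]; [B7] = [Balaban1985Averaging]; [II] = [Balaban1984PropagatorsII].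

THE GEOMETRY (any torus `P` in the standing range, `L ≥ 3`, period `> 2L`, three distinct axes `μ₀, ν₁, κ₂`): the fine sites `x = π(−e_{μ₀} − e_{ν₁})`, `x₁ = x + e_{ν₁} = π(−e_{μ₀})`,
`x₁′ = x₁ + e_{ν₁}`; the coarse site `y₁ = −e_{μ₀}` (so `x₁, x₁′ ∈ B(y₁)` sit on the far face of `B(y₁)` in direction `μ₀`, at transverse offsets `0` and `e_{ν₁}`, both off the
central axis in the coordinate `κ₂`), and `y₂ = y₁ − e_{ν₁} = blockOf x`.  THE CONFIGURATIONS: `U = (g₀ on ⟨x, μ₀⟩, 1 elsewhere)` (a twisted EXTERIOR bond of the block `B(0)`) and its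
two-connector twist `V = (g on ⟨x₁, μ₀⟩) · (g⁻¹ on ⟨x₁′, μ₀⟩) · U` (`|g − 1| < δ_N`).
WHAT IS PROVED: §1 coordinates and blocks of these sites; §2 ★★ `avgFun_twist_eq` — for Bałaban's (0.4) averaging of record `blockAvg expMeanLogSU`, `V̄(c) = Ū(c)` for EVERY
coarse bond `c`: at `c⋆ = ⟨y₁, μ₀⟩` both sides are `1` (part A′ `avgFun_twoBond_star_eq_one` + locality; `Ū(c⋆) = 1̄(c⋆)`); at the other coarse bonds touching `y₁` the (0.4) box
misses, in the coordinate `μ₀`, the far ends `x₁ + e_{μ₀}, x₁′ + e_{μ₀}` of the twisted connectors (part A `avgFun_congr_of_coord`); elsewhere locality (`Averaging.local_dep`);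
§3 hence ★★ `iter_twist_eq` — every iterated average `M^j`, `j ≥ 1`, of `V` equals that of `U`.
This is the «print-admissible» half of the counter-model to HSEAM (director-ym №335 (B), dag-n07-e `LOCATE-HSEAM` (γ)): along `t ↦ V(g(t))` every [II] (2.3) `Λ_j`-average,
`j ≥ 1`, is constant, and at level 0 only the two connectors move (part C).

HONEST FRAMING: kernel bookkeeping about the tree's averaging on explicit configurations; nothing of Bałaban [I]∕[B7]∕[II] asserted or refuted; used ONLY by part C to certify that
HSEAM AS DISPLAYED is uninhabited; it does not bear on (E1)∕(E3); K0⁷ stub 1 NOT closed; N05 ∕ N07 NOT discharged; counts unmoved (typed 28∕28 · discharged 8∕28); one finite 𝕋⁴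
programme at fixed ε — R4 closes the conditional finite-𝕋⁴ rung `BalabanLadder.UV` only; the YM mass gap (Clay) is NOT proved by any of this; nothing continuum ∕ ℝ⁴ ∕ OS.
No `def`, no `instance`, no `notation`, no `sorry`.

References: [I] (0.1) p. 251, (0.3)–(0.4) pp. 252–253; [B7] p. 19 (locality); [II] (2.3) p. 224.
-/

set_option autoImplicit false

noncomputable section

open scoped Matrix.Norms.L2Operator BigOperators

namespace Summit.QuantumFields.YangMills.BalabanUVNodes.N07SeamWitness

open Literature.MathematicalPhysics.QuantumFieldTheory.Balaban1983to89
open Literature.MathematicalPhysics.QuantumFieldTheory.Balaban1983to89.Node00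
open Literature.MathematicalPhysics.QuantumFieldTheory.Balaban1983to89.T4Continuum
open B15Eq112TorusCover B14DomainGeom BlockAveraging
open ExpMeanLog (deltaSU expMeanLogSU)
open Literature.MathematicalPhysics.QuantumFieldTheory.Balaban1983to89.T3DescentFibreTower (avgFun_one expMeanLogSU_E_one)
open Summit.QuantumFields.YangMills.Theorems.K0BgProvisoOverRange (shift_cover)
open Summit.QuantumFields.YangMills.Theorems.K0AveragedSingleBondFloor (intCast_ne_zero_of_natAbs_lt)

variable {P : Params}

/-! ## §1  Coordinates and blocks -/
section Geometry

/-- The centre of the block `B(−e_{μ₀})`, coordinatewise: `h` transversally, `h − L` along `μ₀` (`h = (L−1)∕2`). [cite: Balaban1987RG1, (0.1)–(0.3) pp.251–252 (bookkeeping)] -/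
theorem emb_unshift_zero_apply (μ0 κ : Fin P.d) :
    emb ((0 : Site P 1).unshift μ0) κ = (((P.L - 1) / 2 : ℕ) : ZMod (P.sitesPerDir 0)) - (if κ = μ0 then (P.L : ZMod (P.sitesPerDir 0)) else 0) := by
  have hemb0 : emb (0 : Site P 1) κ = (((P.L - 1) / 2 : ℕ) : ZMod (P.sitesPerDir 0)) := by
    show (((((0 : Site P 1) κ).val * P.L + (P.L - 1) / 2 : ℕ)) : ZMod (P.sitesPerDir 0)) = _
    rw [Site.zero_apply, ZMod.val_zero, zero_mul, zero_add]
  have h1 := emb_shift_apply ((0 : Site P 1).unshift μ0) μ0 κ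
  rw [Site.shift_unshift, hemb0] at h1
  rw [h1]; ring

/-- The centre of the block `B(−e_{μ₀} − e_{ν})`. [cite: Balaban1987RG1, (0.1)–(0.3) pp.251–252 (bookkeeping)] -/
theorem emb_unshift_unshift_zero_apply (μ0 ν κ : Fin P.d) :
    emb (((0 : Site P 1).unshift μ0).unshift ν) κ =
      (((P.L - 1) / 2 : ℕ) : ZMod (P.sitesPerDir 0)) - (if κ = μ0 then (P.L : ZMod (P.sitesPerDir 0)) else 0)
        - (if κ = ν then (P.L : ZMod (P.sitesPerDir 0)) else 0) := by
  have h1 := emb_shift_apply (((0 : Site P 1).unshift μ0).unshift ν) ν κ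
  rw [Site.shift_unshift, emb_unshift_zero_apply] at h1
  rw [h1]; ring

/-- Coordinates of `π(w) + e_ν`. [cite: Balaban1987RG1, (0.1) p.251 (bookkeeping)] -/
theorem cover_shift_apply (w : Pt P.d) (ν κ : Fin P.d) :
    ((cover P w).shift ν) κ = ((w κ : ℤ) : ZMod (P.sitesPerDir 0)) + (if κ = ν then 1 else 0) := by
  rw [Site.shift_apply, cover_apply, cover_apply]
  by_cases hκ : κ = ν
  · subst hκ; simp
  · simp [hκ]

/-- **A fine site within sup-distance `h` of the centre of `B(y)` lies in `B(y)`** — the interface sites `x₁ = π(−e_{μ₀})`, `x₁′ = x₁ + e_{ν₁}` lie in `B(−e_{μ₀})` and the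
exterior site `x = π(−e_{μ₀} − e_{ν₁})` in `B(−e_{μ₀} − e_{ν₁})` (standing range, `L ≥ 3`). [cite: Balaban1987RG1, (0.3) p.252 (bookkeeping)] -/
theorem blockOf_cover_corner (hj : 0 + 1 ≤ P.m + P.K) (hL : 3 ≤ P.L) {μ0 ν₁ : Fin P.d} (hne : ν₁ ≠ μ0) :
    blockOf (cover P (fun i => if i = μ0 ∨ i = ν₁ then (-1 : ℤ) else 0)) = ((0 : Site P 1).unshift μ0).unshift ν₁ ∧
    blockOf ((cover P (fun i => if i = μ0 ∨ i = ν₁ then (-1 : ℤ) else 0)).shift ν₁) = (0 : Site P 1).unshift μ0 ∧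
    blockOf (((cover P (fun i => if i = μ0 ∨ i = ν₁ then (-1 : ℤ) else 0)).shift ν₁).shift ν₁) = (0 : Site P 1).unshift μ0 := by
  set hh : ℕ := (P.L - 1) / 2 with hhh
  have hL2 : 2 * hh + 1 = P.L := AveragingRT.two_mul_half_add_one P
  have hc : ((P.L : ℕ) : ZMod (P.sitesPerDir 0)) = 2 * ((hh : ℕ) : ZMod (P.sitesPerDir 0)) + 1 := by
    rw [← hL2]; push_cast; ring
  set w₀ : Pt P.d := fun i => if i = μ0 ∨ i = ν₁ then (-1 : ℤ) else 0 with hw₀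
  have hw₀μ : w₀ μ0 = -1 := by simp [hw₀]
  have hw₀ν : w₀ ν₁ = -1 := by simp [hw₀]
  have hw₀o : ∀ κ, κ ≠ μ0 → κ ≠ ν₁ → w₀ κ = 0 := fun κ h1 h2 => by simp [hw₀, h1, h2]
  refine ⟨?_, ?_, ?_⟩
  · refine blockOf_eq_of_near_emb hj _ _ (fun κ => if κ = μ0 ∨ κ = ν₁ then (hh : ℤ) else -(hh : ℤ)) (fun κ => ?_) (fun κ => ?_)
    · rw [cover_apply, emb_unshift_unshift_zero_apply]
      by_cases h1 : κ = μ0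
      · subst h1; rw [if_pos rfl, if_neg (Ne.symm hne), hw₀μ, if_pos (Or.inl rfl), hc]; push_cast; ring
      · by_cases h2 : κ = ν₁
        · subst h2; rw [if_neg h1, if_pos rfl, hw₀ν, if_pos (Or.inr rfl), hc]; push_cast; ring
        · rw [if_neg h1, if_neg h2, hw₀o κ h1 h2, if_neg (by push Not; exact ⟨h1, h2⟩)]; push_cast; ring
    · by_cases h : κ = μ0 ∨ κ = ν₁
      · rw [if_pos h]; constructor <;> omega
      · rw [if_neg h]; constructor <;> omega
  · refine blockOf_eq_of_near_emb hj _ _ (fun κ => if κ = μ0 then (hh : ℤ) else -(hh : ℤ)) (fun κ => ?_) (fun κ => ?_)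
    · rw [cover_shift_apply, emb_unshift_zero_apply]
      by_cases h1 : κ = μ0
      · subst h1; rw [if_pos rfl, if_neg (Ne.symm hne), hw₀μ, if_pos rfl, hc]; push_cast; ring
      · by_cases h2 : κ = ν₁
        · subst h2; rw [if_neg h1, if_pos rfl, hw₀ν, if_neg h1]; push_cast; ring
        · rw [if_neg h1, if_neg h2, hw₀o κ h1 h2, if_neg h1]; push_cast; ring
    · by_cases h : κ = μ0
      · rw [if_pos h]; constructor <;> omega
      · rw [if_neg h]; constructor <;> omega
  · refine blockOf_eq_of_near_emb hj _ _ (fun κ => if κ = μ0 then (hh : ℤ) else if κ = ν₁ then 1 - (hh : ℤ) else -(hh : ℤ)) (fun κ => ?_) (fun κ => ?_)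
    · rw [Site.shift_apply, cover_shift_apply, emb_unshift_zero_apply]
      by_cases h1 : κ = μ0
      · subst h1
        rw [if_neg (Ne.symm hne), cover_shift_apply, hw₀μ, if_neg (Ne.symm hne), if_pos rfl, if_pos rfl, hc]; push_cast; ring
      · by_cases h2 : κ = ν₁
        · subst h2; rw [if_pos rfl, hw₀ν, if_pos rfl, if_neg h1, if_neg h1, if_pos rfl]; push_cast; ring
        · rw [if_neg h2, cover_shift_apply, hw₀o κ h1 h2, if_neg h2, if_neg h1, if_neg h1, if_neg h2]; push_cast; ring
    · by_cases h : κ = μ0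
      · rw [if_pos h]; constructor <;> omega
      · rw [if_neg h]
        by_cases h' : κ = ν₁
        · rw [if_pos h']; constructor <;> omega
        · rw [if_neg h']; constructor <;> omega

/-- The blocks `B(−e_{μ₀} − e_{ν₁})`, `B(−e_{μ₀})`, `B(0)` are pairwise distinct (`ν₁ ≠ μ₀`; coarse period `> 1`). [cite: Balaban1987RG1, (0.1) p.251 (bookkeeping)] -/
theorem unshift_ne {μ0 ν₁ : Fin P.d} (hne : ν₁ ≠ μ0) :
    ((0 : Site P 1).unshift μ0).unshift ν₁ ≠ (0 : Site P 1).unshift μ0 ∧ ((0 : Site P 1).unshift μ0).unshift ν₁ ≠ ((0 : Site P 1).unshift μ0).shift μ0 ∧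
    (0 : Site P 1).unshift μ0 ≠ ((0 : Site P 1).unshift μ0).shift μ0 := by
  haveI : Fact (1 < P.sitesPerDir 1) := ⟨P.one_lt_sitesPerDir 1⟩
  have key : ∀ (z z' : Site P 1) (ν : Fin P.d), z ν = z' ν - 1 → z ≠ z' := by
    intro z z' ν h habs
    rw [habs] at h
    have h0 : (1 : ZMod (P.sitesPerDir 1)) = 0 := by linear_combination h
    exact one_ne_zero h0
  refine ⟨key _ _ ν₁ ?_, key _ _ ν₁ ?_, key _ _ μ0 ?_⟩
  · rw [Site.unshift_apply, if_pos rfl]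
  · rw [Site.shift_unshift, Site.unshift_apply, if_pos rfl, Site.unshift_apply, if_neg hne]
  · rw [Site.shift_unshift, Site.unshift_apply, if_pos rfl]

end Geometry

/-! ## §2  `V̄(c) = Ū(c)` for every coarse bond `c` -/
section Averages

variable {N : ℕ} [NeZero N]

/-- **THE TWO-CONNECTOR TWIST IS INVISIBLE TO EVERY LEVEL-1 AVERAGE OF RECORD.**  On any torus in the standing range (`L ≥ 3`, period `> 2L`; axes `μ₀, ν₁, κ₂` pairwise
distinct), with `x = π(−e_{μ₀} − e_{ν₁})`, `x₁ = x + e_{ν₁}`, `x₁′ = x₁ + e_{ν₁}`: for Bałaban's (0.4) averaging of record `blockAvg expMeanLogSU` and every `g` with `|g − 1| < δ_N`,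
the configuration `V = (g on ⟨x₁, μ₀⟩)·(g⁻¹ on ⟨x₁′, μ₀⟩)·(g₀ on ⟨x, μ₀⟩)` and `U = (g₀ on ⟨x, μ₀⟩)` (all other bonds `1`) have THE SAME average at EVERY coarse bond `c`:
`c⋆ = ⟨−e_{μ₀}, μ₀⟩` — both `1` (part A′ + locality: the exterior twist issues from `B(−e_{μ₀} − e_{ν₁})`, neither block of `c⋆`); other `c` at `−e_{μ₀}` — the (0.4) box misses
the far ends of the connectors in the coordinate `μ₀` (part A); all other `c` — locality. [cite: Balaban1987RG1, (0.3)–(0.4) pp.252–253; Balaban1985Averaging, p.19 (locality) (bookkeeping)] -/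
theorem avgFun_twist_eq (hj : 0 + 1 ≤ P.m + P.K) (hL : 3 ≤ P.L) (hper : 2 * P.L < P.sitesPerDir 0) {μ0 ν₁ κ₂ : Fin P.d}
    (hνμ : ν₁ ≠ μ0) (hκμ : κ₂ ≠ μ0) (hκν : κ₂ ≠ ν₁) (g g₀ : Matrix.specialUnitaryGroup (Fin N) ℂ) (hg : dist1 g < deltaSU (Fin N))
    (c : PBond P 1) :
    avgFun (expMeanLogSU (n := Fin N))
      (fun b : PBond P 0 =>
        (if b.src = (cover P (fun i => if i = μ0 ∨ i = ν₁ then (-1 : ℤ) else 0)).shift ν₁ ∧ b.dir = μ0 then g else 1) *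
        (if b.src = ((cover P (fun i => if i = μ0 ∨ i = ν₁ then (-1 : ℤ) else 0)).shift ν₁).shift ν₁ ∧ b.dir = μ0 then g⁻¹ else 1) *
        (if b.src = cover P (fun i => if i = μ0 ∨ i = ν₁ then (-1 : ℤ) else 0) ∧ b.dir = μ0 then g₀ else 1)) c =
    avgFun (expMeanLogSU (n := Fin N))
      (fun b : PBond P 0 => if b.src = cover P (fun i => if i = μ0 ∨ i = ν₁ then (-1 : ℤ) else 0) ∧ b.dir = μ0 then g₀ else 1) c := by
  classical
  set hh : ℕ := (P.L - 1) / 2 with hhh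
  have hL2 : 2 * hh + 1 = P.L := AveragingRT.two_mul_half_add_one P
  have hc2 : ((P.L : ℕ) : ZMod (P.sitesPerDir 0)) = 2 * ((hh : ℕ) : ZMod (P.sitesPerDir 0)) + 1 := by
    rw [← hL2]; push_cast; ring
  set w₀ : Pt P.d := fun i => if i = μ0 ∨ i = ν₁ then (-1 : ℤ) else 0 with hw₀
  have hw₀μ : w₀ μ0 = -1 := by simp [hw₀]
  have hw₀ν : w₀ ν₁ = -1 := by simp [hw₀]
  have hw₀o : ∀ κ, κ ≠ μ0 → κ ≠ ν₁ → w₀ κ = 0 := fun κ h1 h2 => by simp [hw₀, h1, h2]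
  set x : Site P 0 := cover P w₀ with hx
  set x₁ : Site P 0 := x.shift ν₁ with hx₁
  set x₁' : Site P 0 := x₁.shift ν₁ with hx₁'
  set y₁ : Site P 1 := (0 : Site P 1).unshift μ0 with hy₁
  set U : GaugeField P 0 (Matrix.specialUnitaryGroup (Fin N) ℂ) := fun b => if b.src = x ∧ b.dir = μ0 then g₀ else 1 with hU
  set VA : GaugeField P 0 (Matrix.specialUnitaryGroup (Fin N) ℂ) := fun b => if b.src = x₁ ∧ b.dir = μ0 then g else 1 with hVA
  set VB : GaugeField P 0 (Matrix.specialUnitaryGroup (Fin N) ℂ) := fun b => if b.src = x₁' ∧ b.dir = μ0 then g⁻¹ else 1 with hVB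
  show avgFun expMeanLogSU (fun b => VA b * VB b * U b) c = avgFun expMeanLogSU U c
  -- blocks
  obtain ⟨hbx, hbx₁, hbx₁'⟩ := blockOf_cover_corner (P := P) hj hL hνμ
  obtain ⟨hy₂₁, hy₂₀, hy₁₀⟩ := unshift_ne (P := P) hνμ
  -- coordinates of the two connectors' sources against `emb y₁`
  have hx₁κ : ∀ κ, x₁ κ = if κ = μ0 then (-1 : ZMod (P.sitesPerDir 0)) else 0 := by
    intro κ
    rw [hx₁, hx, cover_shift_apply]
    by_cases h1 : κ = μ0
    · have h2 : κ ≠ ν₁ := fun h => hνμ (h.symm.trans h1)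
      rw [if_pos h1, if_neg h2, h1, hw₀μ]; push_cast; ring
    · by_cases h2 : κ = ν₁
      · rw [if_neg h1, if_pos h2, h2, hw₀ν]; push_cast; ring
      · rw [if_neg h1, if_neg h2, hw₀o κ h1 h2]; push_cast; ring
  have hx₁'κ : ∀ κ, x₁' κ = if κ = μ0 then (-1 : ZMod (P.sitesPerDir 0)) else if κ = ν₁ then 1 else 0 := by
    intro κ
    rw [hx₁', Site.shift_apply, hx₁κ, hx₁κ, if_neg hνμ]
    by_cases h2 : κ = ν₁
    · have h1 : κ ≠ μ0 := fun h => hνμ (h2.symm.trans h)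
      rw [if_pos h2, if_neg h1, if_pos h2]; ring
    · by_cases h1 : κ = μ0
      · rw [if_neg h2, if_pos h1, if_pos h1]
      · rw [if_neg h2, if_neg h1, if_neg h1, if_neg h2]
  have hemby : ∀ κ, emb y₁ κ = ((hh : ℕ) : ZMod (P.sitesPerDir 0)) - (if κ = μ0 then (P.L : ZMod (P.sitesPerDir 0)) else 0) :=
    fun κ => emb_unshift_zero_apply μ0 κ
  have hx0 : x₁ μ0 = emb y₁ μ0 + ((hh : ℕ) : ZMod (P.sitesPerDir 0)) := by
    rw [hx₁κ, if_pos rfl, hemby, if_pos rfl, hc2]; ring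
  have hx0' : x₁' μ0 = emb y₁ μ0 + ((hh : ℕ) : ZMod (P.sitesPerDir 0)) := by
    rw [hx₁'κ, if_pos rfl, hemby, if_pos rfl, hc2]; ring
  have hxκ : ∀ κ, κ ≠ μ0 → x₁ κ + ((hh : ℕ) : ZMod (P.sitesPerDir 0)) = emb y₁ κ + (((fun _ : Fin P.d => (0 : ℕ)) κ : ℕ) : ZMod (P.sitesPerDir 0)) := by
    intro κ hκ; rw [hx₁κ, if_neg hκ, hemby, if_neg hκ]; push_cast; ring
  have hxκ' : ∀ κ, κ ≠ μ0 → x₁' κ + ((hh : ℕ) : ZMod (P.sitesPerDir 0)) =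
      emb y₁ κ + (((fun i : Fin P.d => if i = ν₁ then (1 : ℕ) else 0) κ : ℕ) : ZMod (P.sitesPerDir 0)) := by
    intro κ hκ
    rw [hx₁'κ, if_neg hκ, hemby, if_neg hκ]
    by_cases h2 : κ = ν₁
    · simp only [h2, if_true]; push_cast; ring
    · simp only [h2, if_false]; push_cast; ring
  have hh1 : 1 ≤ hh := by omega
  -- the far ends of the two connectors have `μ₀`-coordinate `0`
  have htgt : ∀ b : PBond P 0, VA b * VB b * U b ≠ U b → b.tgt μ0 = 0 := by
    intro b hb
    have hb' : (b.src = x₁ ∧ b.dir = μ0) ∨ (b.src = x₁' ∧ b.dir = μ0) := by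
      by_contra hcon
      push Not at hcon
      apply hb
      simp only [hVA, hVB]
      rw [if_neg (fun h => hcon.1 h.1 h.2), if_neg (fun h => hcon.2 h.1 h.2), one_mul, one_mul]
    rcases hb' with ⟨h1, h2⟩ | ⟨h1, h2⟩
    · show (b.src.shift b.dir) μ0 = 0
      rw [h1, h2, Site.shift_apply, if_pos rfl, hx₁κ, if_pos rfl]; ring
    · show (b.src.shift b.dir) μ0 = 0
      rw [h1, h2, Site.shift_apply, if_pos rfl, hx₁'κ, if_pos rfl]; ring
  -- the twisted connectors issue from `B(y₁)`
  have hsrc : ∀ b : PBond P 0, VA b * VB b * U b ≠ U b → blockOf b.src = y₁ := by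
    intro b hb
    by_contra hcon
    apply hb
    simp only [hVA, hVB]
    rw [if_neg, if_neg, one_mul, one_mul]
    · rintro ⟨h1, -⟩; exact hcon (by rw [h1]; exact hbx₁')
    · rintro ⟨h1, -⟩; exact hcon (by rw [h1]; exact hbx₁)
  by_cases hc : c.src = y₁ ∨ c.tgt = y₁
  swap
  · -- locality: `c` does not touch `B(y₁)`
    push Not at hc
    refine avgFun_local _ hj _ _ c (fun b hb => ?_)
    by_contra hne
    have := hsrc b hne
    rcases hb with h | h
    · exact hc.1 (h.symm.trans this)
    · exact hc.2 (h.symm.trans this)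
  by_cases hstar : c.src = y₁ ∧ c.dir = μ0
  · -- `c = c⋆`
    have hceq : c = ⟨y₁, μ0⟩ := by
      obtain ⟨c₁, c₂⟩ := c
      obtain ⟨h1, h2⟩ := hstar
      simp only at h1 h2
      rw [h1, h2]
    subst hceq
    -- drop the exterior twist by locality, then part A′
    have hloc : avgFun (expMeanLogSU (n := Fin N)) (fun b => VA b * VB b * U b) ⟨y₁, μ0⟩ =
        avgFun (expMeanLogSU (n := Fin N)) (fun b => VA b * VB b) ⟨y₁, μ0⟩ := by
      refine avgFun_local _ hj _ _ _ (fun b hb => ?_)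
      have hUb : U b = 1 := by
        simp only [hU]
        rw [if_neg]
        rintro ⟨h1, -⟩
        rw [h1, hbx] at hb
        rcases hb with h | h
        · exact hy₂₁ h
        · exact hy₂₀ h
      simp only [hUb, mul_one]
    have hlocU : avgFun (expMeanLogSU (n := Fin N)) U ⟨y₁, μ0⟩ = avgFun (expMeanLogSU (n := Fin N)) (1 : GaugeField P 0 _) ⟨y₁, μ0⟩ := by
      refine avgFun_local _ hj _ _ _ (fun b hb => ?_)
      simp only [hU]
      rw [if_neg]
      · rfl
      rintro ⟨h1, -⟩
      rw [h1, hbx] at hb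
      rcases hb with h | h
      · exact hy₂₁ h
      · exact hy₂₀ h
    rw [hloc, hlocU, avgFun_one _ expMeanLogSU_E_one]
    show avgFun expMeanLogSU (fun b => VA b * VB b) ⟨y₁, μ0⟩ = 1
    refine avgFun_twoBond_star_eq_one hper hL hκμ hνμ y₁ x₁ x₁' g hg (fun _ => 0) (fun i => if i = ν₁ then 1 else 0)
      (fun _ => P.L_pos) (fun i => by by_cases h : i = ν₁ <;> simp [h] <;> omega) (by omega) (by simp [hκν]; omega)
      (by simp) (fun κ hκ => by simp [hκ]) hx0 hxκ hx0' hxκ'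
  · -- `c` touches `y₁` but is not `c⋆`: avoidance in the coordinate `μ₀`
    refine avgFun_congr_of_coord _ c _ _ μ0 (fun b hb e he1 he2 => ?_)
    rw [htgt b hb]
    -- `emb c₋ μ₀ + e ≠ 0`
    have hsrcμ : emb c.src μ0 = ((hh : ℕ) : ZMod (P.sitesPerDir 0)) - (P.L : ZMod (P.sitesPerDir 0)) -
        (if c.dir = μ0 then (P.L : ZMod (P.sitesPerDir 0)) else 0) := by
      rcases hc with h | h
      · -- `c.src = y₁`, so `c.dir ≠ μ₀`
        have hd : c.dir ≠ μ0 := fun h' => hstar ⟨h, h'⟩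
        rw [h, hemby, if_pos rfl, if_neg hd, sub_zero]
      · -- `c.tgt = y₁`: `c.src = y₁ − e_{c.dir}`
        have hs : c.src = y₁.unshift c.dir := by rw [← h]; exact (Site.unshift_shift c.src c.dir).symm
        have h1 := emb_shift_apply (y₁.unshift c.dir) c.dir μ0
        rw [Site.shift_unshift, ← hs] at h1
        -- `emb y₁ μ0 = emb c.src μ0 + [μ0 = c.dir] L`
        rw [hemby, if_pos rfl] at h1
        by_cases hd : c.dir = μ0
        · rw [if_pos hd.symm] at h1; rw [if_pos hd]; linear_combination -h1
        · rw [if_neg (Ne.symm hd)] at h1; rw [if_neg hd]; linear_combination -h1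
    rw [hsrcμ]
    intro habs
    by_cases hd : c.dir = μ0
    · rw [if_pos hd] at habs he2
      -- `hh − 2L + e = 0` with `−hh ≤ e ≤ L + hh`: the integer `hh − 2L + e ∈ [−2L, −1]`
      have hc' : ((((hh : ℕ) : ℤ) - 2 * (P.L : ℤ) + e : ℤ) : ZMod (P.sitesPerDir 0)) = 0 := by
        rw [← habs]; push_cast; ring
      have hne : (((hh : ℕ) : ℤ) - 2 * (P.L : ℤ) + e : ℤ) ≠ 0 := by omega
      have hlt : ((((hh : ℕ) : ℤ) - 2 * (P.L : ℤ) + e : ℤ)).natAbs < P.sitesPerDir 0 := by omega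
      exact intCast_ne_zero_of_natAbs_lt hne hlt hc'
    · rw [if_neg hd] at habs he2
      have hc' : ((((hh : ℕ) : ℤ) - (P.L : ℤ) + e : ℤ) : ZMod (P.sitesPerDir 0)) = 0 := by
        rw [← habs]; push_cast; ring
      have hne : (((hh : ℕ) : ℤ) - (P.L : ℤ) + e : ℤ) ≠ 0 := by omega
      have hlt : ((((hh : ℕ) : ℤ) - (P.L : ℤ) + e : ℤ)).natAbs < P.sitesPerDir 0 := by omega
      exact intCast_ne_zero_of_natAbs_lt hne hlt hc'

/-! ## §3  All iterated averages `M^j`, `j ≥ 1`, agree -/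

/-- **EVERY ITERATED AVERAGE OF RECORD `M^j`, `j ≥ 1`, OF THE TWISTED CONFIGURATION EQUALS THAT OF `U`** (the averaging maps of record are `blockAvg expMeanLogSU` at every
level, `Node00.avOfRecord_apply`; level `1` is §2, higher levels read level `1`). [cite: Balaban1987RG1, (0.11) p.253, (0.21) p.256 (bookkeeping)] -/
theorem iter_twist_eq (av : ∀ j, Averaging P j (Matrix.specialUnitaryGroup (Fin N) ℂ)) (hav : av 0 = blockAvg (expMeanLogSU (n := Fin N)))
    (hj : 0 + 1 ≤ P.m + P.K) (hL : 3 ≤ P.L) (hper : 2 * P.L < P.sitesPerDir 0) {μ0 ν₁ κ₂ : Fin P.d}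
    (hνμ : ν₁ ≠ μ0) (hκμ : κ₂ ≠ μ0) (hκν : κ₂ ≠ ν₁) (g g₀ : Matrix.specialUnitaryGroup (Fin N) ℂ) (hg : dist1 g < deltaSU (Fin N))
    (j : ℕ) (hj1 : 1 ≤ j) :
    Averaging.iter av j
      (fun b : PBond P 0 =>
        (if b.src = (cover P (fun i => if i = μ0 ∨ i = ν₁ then (-1 : ℤ) else 0)).shift ν₁ ∧ b.dir = μ0 then g else 1) *
        (if b.src = ((cover P (fun i => if i = μ0 ∨ i = ν₁ then (-1 : ℤ) else 0)).shift ν₁).shift ν₁ ∧ b.dir = μ0 then g⁻¹ else 1) *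
        (if b.src = cover P (fun i => if i = μ0 ∨ i = ν₁ then (-1 : ℤ) else 0) ∧ b.dir = μ0 then g₀ else 1)) =
    Averaging.iter av j (fun b : PBond P 0 => if b.src = cover P (fun i => if i = μ0 ∨ i = ν₁ then (-1 : ℤ) else 0) ∧ b.dir = μ0 then g₀ else 1) := by
  induction j with
  | zero => omega
  | succ j ih =>
    rcases Nat.eq_zero_or_pos j with rfl | hjpos
    · show (av 0).avg (Averaging.iter av 0 _) = (av 0).avg (Averaging.iter av 0 _)
      rw [hav]
      show avgFun expMeanLogSU _ = avgFun expMeanLogSU _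
      funext c
      exact avgFun_twist_eq hj hL hper hνμ hκμ hκν g g₀ hg c
    · show (av j).avg (Averaging.iter av j _) = (av j).avg (Averaging.iter av j _)
      rw [ih hjpos]

end Averages

end Summit.QuantumFields.YangMills.BalabanUVNodes.N07SeamWitness

end
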